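import Literature.NumberTheory.Automorphic.ThorneQInfinityModularTowerProofs
import Literature.NumberTheory.Automorphic.TotallyRealModularityBoxImagesProofs
import HarnessLib

/-!
# Thorne 2019, Lemma 3 from its printed inputs: Theorem 2 (FLS 2015, Thm. 3 and Thorne 2016,
# Thm. 7.5), modularity over `ℚ` and cyclic base change (proofs)

Topic `Literature/NumberTheory/Automorphic`; a *proofs* file (theorems only: no definition, no
named fact, no instance) continuing `ThorneQInfinityModularProofs` and
`ThorneQInfinityModularTowerProofs`, which closed the named fact
`Literature.NumberTheory.Automorphic.Thorne2019_lemma3` (`ThorneQInfinityModular`; J. A. Thorne,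
*Elliptic curves over `ℚ_∞` are modular*, JEMS 21 (2019), Lemma 3) modulo the two named facts
`Box2022_theorem1_3` and `isModularEllipticCurve_baseChange_rat_of_isSolvable`
(`Thorne2019_lemma3_of_facts`).

The first of these is more than the printed proof uses. Thorne (p. 4 of the held text
`paper:arxiv-1505.04769`, verbatim): "Lemma 3. (1) If `E` is an elliptic curve over `F` which is
not modular, then `E` determines an `F`-rational point of one of the curves `X(s3, b5)`,
`X(b3, b5)`. (2) … *Proof.* (1) is a consequence of Theorem 2 and [Fre13]. (2) is a consequence of
(1), the modularity of all elliptic curves over `ℚ`, and cyclic base change for `GL₂` [Lan80]."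
Here Theorem 2 is: "`F` totally real, `√5 ∉ F`, `E / F`; if `ρ̄_{E,3}(G_{F(ζ₃)})` is absolutely
irreducible [Kisin, Langlands–Tunnell, FLHS = FLS 2015, Thm. 3 at `p = 3`] or `ρ̄_{E,5}` is
irreducible [Tho15 = Thorne 2016, Thm. 7.6], then `E` is modular", and "[Fre13]" supplies the group
theory (FLS 2015, Prop. 9.1 (a): not absolutely irreducible over `F(ζ₃)` ⇒ image in `B(3)` or in
the normaliser of a split Cartan subgroup — PROVED in the tree,
`FLS2015.mod3_dichotomy_of_not_isAutomorphicOfWeightZero` / `Box2022.clause_three`). Box 2022,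
Thm. 1.3 packages the same two clauses (i), (ii) together with a third clause (iii) at `p = 7`
(from FLS 2015, Thm. 4 and Kalyanswamy 2018, Thm. 1.2), which Thorne's proof never touches.

This file therefore re-routes the landed proof of Lemma 3 through exactly the printed inputs:

* `Thorne2019.isModularEllipticCurve_of_images_of_forall_baseChange` — the **field-local core** of
  Lemma 3 (2): over a totally real `K` with `E₁(K) = E₁(ℚ)`, `E₂(K) = E₂(ℚ)`, IF every non-modular
  `E / 𝓞 K` has mod-`3` image in `B(3)` or `C_s⁺(3)` and mod-`5` image in `B(5)` (for suitable
  framings), and every base change `E₀ ⊗ 𝓞 K` of an integral `E₀ / ℤ` is modular, THEN every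
  `E / 𝓞 K` with `Δ ≠ 0` is modular. (No `√5`, Galois or cyclicity hypothesis is used at this
  level: they only serve to produce the two inputs.) The proof is that of
  `Thorne2019_lemma3_of_forall_baseChange`, verbatim, with the level structures taken from the
  hypothesis instead of `Box2022_theorem1_3`.
* `Thorne2019_lemma3_of_images` — Lemma 3 from the two image clauses (i), (ii) for totally real
  fields with `√5 ∉ K` (an abstract form of "Theorem 2 and [Fre13]") and the base-change fact.
* `Thorne2019_lemma3_of_theorem3_of_theorem7_6` — Lemma 3 from `FLS2015_theorem3`, any proof of
  Thorne 2016, Thm. 7.6 on the strong carrier (`h76`, the binder of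
  `Box2022_theorem1_3_five_of_theorem7_6` / `Thorne2019_thm2_five_of_theorem7_6`), and the
  base-change fact.
* `Thorne2019_lemma3_of_liftingTheorems` — **Lemma 3 from `FLS2015_theorem3`, Thorne 2016,
  Thm. 7.5 for `ρ_{E,p}` (hypothesis (T), the binder of `Thorne2016_theorem7_6_of_dihedralLifting`,
  token for token) and `isModularEllipticCurve_baseChange_rat_of_isSolvable`** — the printed proof's
  inputs and nothing at `p = 7`.
* `Thorne2019_lemma3_of_liftingTheorems_of_one_lt_finrank` — the same for every `K` with
  `[K : ℚ] > 1`, with the base-change fact replaced by its three printed inputs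
  (`exists_isNewformOf`, `baseChange_cyclic_cuspidal`, `ArthurClozel1989_strongLifting_archimedean`)
  through `isModularEllipticCurve_baseChange_of_one_lt_finrank`.
* `Thorne2019.isModularEllipticCurve_of_nonModularImages_of_forall_baseChange`,
  `Thorne2019.nonModularImages_of_theorem2`, `Thorne2019_lemma3_of_theorem2`,
  `Thorne2019_lemma3_of_theorem2_of_one_lt_finrank` — the same with the image dichotomy asked
  only of non-*modular* curves, so that the second alternative of Theorem 2 enters through the
  named fact `Thorne2019_thm2_five` of `ThorneQInfinityModular` (conclusion
  `IsModularEllipticCurve`) instead of a strong-carrier binder: **Lemma 3 from the three named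
  facts `FLS2015_theorem3`, `Thorne2019_thm2_five`,
  `isModularEllipticCurve_baseChange_rat_of_isSolvable`.**

Finer inputs compose in one line: `FLS2015_theorem3` is itself reduced to Cor. 5.1 / Thm. 2 at
`p = 5` / Lemma 6.1 of FLS 2015 and `strongArtin_of_isSolvable` in `FLSThreeFiveSwitchingProofs`
(`FLS2015_theorem3_of_strongArtin_of_liftingAtThree_of_switching`), whose output feeds `h3` below.

## References

* J. A. Thorne, *Elliptic curves over `ℚ_∞` are modular*, J. Eur. Math. Soc. 21 (2019), Lemma 3
  and its proof, Thm. 2 and its proof, Prop. 4 (p. 4 of `paper:arxiv-1505.04769`). [Thorne2019]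
* J. A. Thorne, *Automorphy of some residually dihedral Galois representations*, Math. Ann. 364
  (2016), Thms. 7.5, 7.6. [Thorne2016]
* N. Freitas, B. V. Le Hung, S. Siksek, *Elliptic curves over real quadratic fields are
  modular*, Invent. Math. 201 (2015), Thm. 3, Prop. 9.1 (a). [FreitasLeHungSiksek2015]
* J. Box, *Elliptic curves over totally real quartic fields not containing `√5` are modular*,
  Trans. Amer. Math. Soc. 375 (2022), Thm. 1.3. [Box2022]
-/

noncomputable section

namespace Literature.NumberTheory.Automorphic

open scoped _root_.NumberField MatrixGroups
open _root_.NumberField _root_.Field Literature.NumberTheory.GaloisRepresentations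

/-! ### The field-local core of Lemma 3 (2) -/

namespace Thorne2019

/-- **Thorne 2019, Lemma 3 (2) at a fixed totally real field `K`, from the image dichotomy of
non-modular curves over `K` and the modularity of base changes `E₀ ⊗ K`.** Let `K` be totally real
with `E₁(K) = E₁(ℚ)` and `E₂(K) = E₂(ℚ)`. Suppose that (a) every `E / 𝓞 K` with `Δ ≠ 0` that is
not automorphic of weight zero admits a framing of `E[3]` with image in `B(3)` or in
`C_s⁺(3) = ⟨diag(1,2), (0 1; 1 0)⟩` and a framing of `E[5]` with image in `B(5)` (Lemma 3 (1) in
the form "Theorem 2 and [Fre13]"), and (b) `E₀ ⊗ 𝓞 K` is modular for every integral `E₀ / ℤ` with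
`Δ(E₀) ≠ 0` ("the modularity of all elliptic curves over `ℚ`, and cyclic base change"). Then every
`E / 𝓞 K` with `Δ ≠ 0` is modular. Proof = that of `Thorne2019_lemma3_of_forall_baseChange`: the
level structures make `E` a `K`-point of `X₀(15) ≅ E₁` or `X(s3, b5) ≅ E₂` (`moduli_X0_15`,
`exists_ratCast_eq_of_pointsRational`, `exists_ratCast_j_of_splitCartan`), rational by hypothesis,
so `j(E) ∈ ℚ`; `j ∈ {0, 1728}` is CM, otherwise the door
`isModularEllipticCurve_of_jInvariant_eq_ratCast_of_forall_baseChange` applies.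
[cite: Thorne2019, Lemma 3 and its proof, Prop. 4] -/
theorem isModularEllipticCurve_of_images_of_forall_baseChange
    (K : Type) [Field K] [NumberField K] [IsTotallyReal K]
    (h₁ : PointsRational E₁ K) (h₂ : PointsRational E₂ K)
    (hImg : ∀ E : WeierstrassCurve (𝓞 K), E.Δ ≠ 0 → ¬ IsAutomorphicOfWeightZero E →
      (∃ ρ : FramedGaloisRep K (ZMod 3) 2, (E.baseChange K).IsTorsionGaloisRep 3 ρ ∧
        ((∀ σ : absoluteGaloisGroup K,
            ((ρ σ : GL (Fin 2) (ZMod 3)) : Matrix (Fin 2) (Fin 2) (ZMod 3)) 1 0 = 0) ∨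
          (∀ σ : absoluteGaloisGroup K, (ρ σ : GL (Fin 2) (ZMod 3)) ∈
            Subgroup.closure ({(⟨!![1, 0; 0, 2], !![1, 0; 0, 2], by decide, by decide⟩ :
                GL (Fin 2) (ZMod 3)),
              (⟨!![0, 1; 1, 0], !![0, 1; 1, 0], by decide, by decide⟩ : GL (Fin 2) (ZMod 3))} :
              Set (GL (Fin 2) (ZMod 3)))))) ∧
      ∃ ρ : FramedGaloisRep K (ZMod 5) 2, (E.baseChange K).IsTorsionGaloisRep 5 ρ ∧
        ∀ σ : absoluteGaloisGroup K,
          ((ρ σ : GL (Fin 2) (ZMod 5)) : Matrix (Fin 2) (Fin 2) (ZMod 5)) 1 0 = 0)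
    (hBCK : ∀ E₀ : WeierstrassCurve ℤ, E₀.Δ ≠ 0 → IsModularEllipticCurve K (E₀.baseChange (𝓞 K)))
    (E : WeierstrassCurve (𝓞 K)) (hΔ : E.Δ ≠ 0) : IsModularEllipticCurve K E := by
  by_contra hE
  -- part (1): level structures of a non-modular curve
  have hnA : ¬ IsAutomorphicOfWeightZero E :=
    not_isAutomorphicOfWeightZero_of_not_isModularEllipticCurve hΔ hE
  obtain ⟨⟨ρ₃, hρ₃, h3⟩, ρ₅, hρ₅, hb5⟩ := hImg E hΔ hnA
  -- the moduli interpretations and `X(K) = X(ℚ)`: `j(E)` is rational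
  have hjrat : ∃ j₀ : ℚ, (algebraMap (𝓞 K) K E.c₄) ^ 3 / algebraMap (𝓞 K) K E.Δ = (j₀ : K) := by
    rcases h3 with hb3 | hs3
    · obtain ⟨S, Jn, Jd, hX⟩ := moduli_X0_15
      rcases hX K E hΔ ⟨ρ₃, hρ₃, hb3⟩ ⟨ρ₅, hρ₅, hb5⟩ with ⟨j₀, -, hj⟩ | ⟨x, y, hxy, hJd, hJ⟩
      · exact ⟨j₀, hj⟩
      · exact exists_ratCast_eq_of_pointsRational h₁ hxy hJd hJ
    · exact exists_ratCast_j_of_splitCartan h₁ h₂ E hΔ ⟨ρ₃, hρ₃, hs3⟩ ⟨ρ₅, hρ₅, hb5⟩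
  obtain ⟨j₀, hj⟩ := hjrat
  -- `j ∈ {0, 1728}`: geometric CM, hence modular in the Caraiani–Newton sense
  letI := FLS2015.isElliptic_baseChange (K := K) hΔ
  have hjK : (E.baseChange K).j = (j₀ : K) := (j_baseChange_eq_div hΔ).trans hj
  by_cases h0 : j₀ = 0
  · refine hE (IsModularEllipticCurve.of_hasCM (WeierstrassCurve.HasCM.of_j_eq_zero ?_))
    rw [hjK, h0, Rat.cast_zero]
  by_cases h1728 : j₀ = 1728
  · refine hE (IsModularEllipticCurve.of_hasCM (WeierstrassCurve.HasCM.of_j_eq_1728 ?_))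
    rw [hjK, h1728]
    norm_num
  -- `j ∉ {0, 1728}`: base change + quadratic twist
  exact hE (isModularEllipticCurve_of_jInvariant_eq_ratCast_of_forall_baseChange K hBCK E hΔ j₀
    h0 h1728 hj)

end Thorne2019

/-! ### Lemma 3 from the image clauses (i), (ii) and the base-change fact -/

/-- **Thorne 2019, Lemma 3 (2), from the level-structure dichotomy (i), (ii) of non-modular curves
over totally real fields with `√5 ∉ K` and `isModularEllipticCurve_baseChange_rat_of_isSolvable`.**
The hypothesis `hImg` is Lemma 3 (1) in the abstract form the proof consumes: for `K` totally real
with `√5 ∉ K` and `E / 𝓞 K` (`Δ ≠ 0`) not automorphic of weight zero, a framing of `E[3]` lands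
in `B(3)` or `C_s⁺(3)` and a framing of `E[5]` in `B(5)` — clauses (i), (ii) of
`Box2022_theorem1_3`, equivalently Theorem 2 of the source with FLS 2015, Prop. 9.1 (a). The cyclic
group `Gal(K/ℚ)` is solvable, so the base-change fact applies at `K`. (With
`hImg := fun K _ _ _ h5 E hΔ hne => ⟨(hBox K E hΔ hne).1, (hBox K E hΔ hne).2.1 h5⟩` this is
`Thorne2019_lemma3_of_facts hBox hBC` again.) [cite: Thorne2019, Lemma 3 and its proof, Thm. 2] -/
theorem Thorne2019_lemma3_of_images
    (hImg : ∀ (K : Type) [Field K] [NumberField K] [IsTotallyReal K], ¬ IsSquare (5 : K) →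
      ∀ E : WeierstrassCurve (𝓞 K), E.Δ ≠ 0 → ¬ IsAutomorphicOfWeightZero E →
        (∃ ρ : FramedGaloisRep K (ZMod 3) 2, (E.baseChange K).IsTorsionGaloisRep 3 ρ ∧
          ((∀ σ : absoluteGaloisGroup K,
              ((ρ σ : GL (Fin 2) (ZMod 3)) : Matrix (Fin 2) (Fin 2) (ZMod 3)) 1 0 = 0) ∨
            (∀ σ : absoluteGaloisGroup K, (ρ σ : GL (Fin 2) (ZMod 3)) ∈
              Subgroup.closure ({(⟨!![1, 0; 0, 2], !![1, 0; 0, 2], by decide, by decide⟩ :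
                  GL (Fin 2) (ZMod 3)),
                (⟨!![0, 1; 1, 0], !![0, 1; 1, 0], by decide, by decide⟩ : GL (Fin 2) (ZMod 3))} :
                Set (GL (Fin 2) (ZMod 3)))))) ∧
        ∃ ρ : FramedGaloisRep K (ZMod 5) 2, (E.baseChange K).IsTorsionGaloisRep 5 ρ ∧
          ∀ σ : absoluteGaloisGroup K,
            ((ρ σ : GL (Fin 2) (ZMod 5)) : Matrix (Fin 2) (Fin 2) (ZMod 5)) 1 0 = 0)
    (hBC : isModularEllipticCurve_baseChange_rat_of_isSolvable) : Thorne2019_lemma3 := by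
  intro K _ _ hK h5 hG hC h₁ h₂ E hΔ
  haveI := hK
  haveI := hG
  haveI := hC
  haveI : IsSolvable (K ≃ₐ[ℚ] K) := isSolvable_of_comm mul_comm'
  exact Thorne2019.isModularEllipticCurve_of_images_of_forall_baseChange K h₁ h₂ (hImg K h5)
    (fun E₀ hE₀ => hBC K E₀ hE₀) E hΔ

/-! ### Lemma 3 from FLS 2015, Thm. 3 and Thorne 2016, Thm. 7.6 / Thm. 7.5 -/

/-- **Thorne 2019, Lemma 3 (2) from `FLS2015_theorem3`, Thorne 2016, Thm. 7.6 (strong carrier) and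
the base-change fact.** Clause (i) is `Box2022.clause_three` (FLS Thm. 3 at `p = 3` and the proved
Prop. 9.1 (a)); clause (ii) is `Box2022_theorem1_3_five_of_theorem7_6` applied to `h76` = "`F`
totally real, `√5 ∉ F`, `E / 𝓞 F` with `Δ ≠ 0` and `E[5]` irreducible ⇒
`IsAutomorphicOfWeightZero E`" (any proof of Thm. 7.6 = Thorne 2019, Thm. 2, second alternative).
[cite: Thorne2019, Lemma 3 and its proof, Thm. 2] [cite: FreitasLeHungSiksek2015, Thm. 3, Prop. 9.1 (a)] [cite: Thorne2016, Thm. 7.6] -/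
theorem Thorne2019_lemma3_of_theorem3_of_theorem7_6 (h3 : FLS2015_theorem3)
    (h76 : ∀ (F : Type) [Field F] [NumberField F] [IsTotallyReal F], ¬ IsSquare (5 : F) →
      ∀ E : WeierstrassCurve (𝓞 F), E.Δ ≠ 0 → (E.baseChange F).HasIrreducibleModPGaloisRep 5 →
        IsAutomorphicOfWeightZero E)
    (hBC : isModularEllipticCurve_baseChange_rat_of_isSolvable) : Thorne2019_lemma3 :=
  Thorne2019_lemma3_of_images
    (fun K _ _ _ h5 E hΔ hne =>
      ⟨Box2022.clause_three h3 K E hΔ hne, Box2022_theorem1_3_five_of_theorem7_6 h76 K E hΔ hne h5⟩)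
    hBC

/-- **Thorne 2019, Lemma 3 (2) from its printed inputs: `FLS2015_theorem3` ("results of Kisin and
Langlands–Tunnell, together with [FLHS]"), Thorne 2016, Thm. 7.5 for `ρ_{E,p}` ("[Tho15]";
hypothesis (T) of `ThorneQInfinityModularTheorem2Proofs`, written out token for token as in
`Thorne2016_theorem7_6_of_dihedralLifting` and `Box2022_theorem1_3_of_liftingTheorems`), and
`isModularEllipticCurve_baseChange_rat_of_isSolvable` ("the modularity of all elliptic curves over
`ℚ`, and cyclic base change for `GL₂` [Lan80]").** Nothing at `p = 7` (FLS Thm. 4, Kalyanswamy's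
Thm. 1.2 — clause (iii) of `Box2022_theorem1_3`) enters. Composition of
`Thorne2016_theorem7_6_of_dihedralLifting` and `Thorne2019_lemma3_of_theorem3_of_theorem7_6`.
[cite: Thorne2019, Lemma 3 and its proof, Thm. 2 and its proof] [cite: Thorne2016, Thms. 7.5, 7.6] [cite: FreitasLeHungSiksek2015, Thm. 3] -/
theorem Thorne2019_lemma3_of_liftingTheorems (h3 : FLS2015_theorem3)
    (hT : ∀ (F : Type) [Field F] [NumberField F] [IsTotallyReal F] (p : ℕ) [Fact p.Prime], p ≠ 2 →
      ∀ (E : WeierstrassCurve (𝓞 F)), E.Δ ≠ 0 →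
        ∀ ρ : ModPGaloisRep F (ZMod p) 2, (E.baseChange F).IsTorsionGaloisRep p ρ →
          FramedRep.IsAbsolutelyIrreducible ρ →
          ∀ (L : Type) [Field L] [Algebra F L] [IsCyclotomicExtension {p} F L],
            (∃ (k : Type) (_ : Field k) (f : ZMod p →+* k) (Q : GL (Fin 2) k),
                (∀ τ : absoluteGaloisGroup L,
                  Q * Matrix.GeneralLinearGroup.map f (FramedGaloisRep.restrictField L ρ τ) * Q⁻¹ ∈
                    Serre1972.diagonalSubgroup k) ∧
                ∃ τ : absoluteGaloisGroup L,
                  ((Q * Matrix.GeneralLinearGroup.map f (FramedGaloisRep.restrictField L ρ τ) *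
                      Q⁻¹ : GL (Fin 2) k) : Matrix (Fin 2) (Fin 2) k) 0 0 ≠
                    ((Q * Matrix.GeneralLinearGroup.map f (FramedGaloisRep.restrictField L ρ τ) *
                      Q⁻¹ : GL (Fin 2) k) : Matrix (Fin 2) (Fin 2) k) 1 1) →
            (∃ (M : Type) (_ : Field M) (_ : Algebra F M),
                Module.finrank F M = 2 ∧ IsTotallyReal M ∧ Nonempty (M →ₐ[F] L)) →
            IsAutomorphicOfWeightZero E)
    (hBC : isModularEllipticCurve_baseChange_rat_of_isSolvable) : Thorne2019_lemma3 :=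
  Thorne2019_lemma3_of_theorem3_of_theorem7_6 h3
    (fun F _ _ _ h5 E hΔ hirr => Thorne2016_theorem7_6_of_dihedralLifting h3 hT F h5 E hΔ hirr) hBC

/-! ### Lemma 3 for `[K : ℚ] > 1` from the lifting theorems and the three printed inputs of cyclic
base change -/

/-- **Thorne 2019, Lemma 3 (2) for every `K` with `[K : ℚ] > 1`, from `FLS2015_theorem3`, Thorne
2016, Thm. 7.5 for `ρ_{E,p}` (hypothesis (T), written out), the Modularity Theorem over `ℚ`
(`exists_isNewformOf`), Arthur–Clozel's cyclic base change of prime degree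
(`baseChange_cyclic_cuspidal`) and its archimedean component
(`ArthurClozel1989_strongLifting_archimedean`).** The field-local core
`Thorne2019.isModularEllipticCurve_of_images_of_forall_baseChange` with (i) from
`Box2022.clause_three`, (ii) from `Box2022_theorem1_3_five_of_theorem7_6` ∘
`Thorne2016_theorem7_6_of_dihedralLifting`, and the base changes `E₀ ⊗ K` modular by
`isModularEllipticCurve_baseChange_of_one_lt_finrank` (the cyclic group `Gal(K/ℚ)` is solvable).
Verbatim `Thorne2019_lemma3` with the extra hypothesis `1 < [K : ℚ]` (the excluded fields are the
copies of `ℚ`, for which Lemma 3 is the Modularity Theorem; see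
`SolvableBaseChangeModularityTowerProofs`).
[cite: Thorne2019, Lemma 3 and its proof, Thm. 2 and its proof] [cite: Thorne2016, Thms. 7.5, 7.6, Lemma 7.1] [cite: FreitasLeHungSiksek2015, Thm. 3] -/
theorem Thorne2019_lemma3_of_liftingTheorems_of_one_lt_finrank (h3 : FLS2015_theorem3)
    (hT : ∀ (F : Type) [Field F] [NumberField F] [IsTotallyReal F] (p : ℕ) [Fact p.Prime], p ≠ 2 →
      ∀ (E : WeierstrassCurve (𝓞 F)), E.Δ ≠ 0 →
        ∀ ρ : ModPGaloisRep F (ZMod p) 2, (E.baseChange F).IsTorsionGaloisRep p ρ →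
          FramedRep.IsAbsolutelyIrreducible ρ →
          ∀ (L : Type) [Field L] [Algebra F L] [IsCyclotomicExtension {p} F L],
            (∃ (k : Type) (_ : Field k) (f : ZMod p →+* k) (Q : GL (Fin 2) k),
                (∀ τ : absoluteGaloisGroup L,
                  Q * Matrix.GeneralLinearGroup.map f (FramedGaloisRep.restrictField L ρ τ) * Q⁻¹ ∈
                    Serre1972.diagonalSubgroup k) ∧
                ∃ τ : absoluteGaloisGroup L,
                  ((Q * Matrix.GeneralLinearGroup.map f (FramedGaloisRep.restrictField L ρ τ) *
                      Q⁻¹ : GL (Fin 2) k) : Matrix (Fin 2) (Fin 2) k) 0 0 ≠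
                    ((Q * Matrix.GeneralLinearGroup.map f (FramedGaloisRep.restrictField L ρ τ) *
                      Q⁻¹ : GL (Fin 2) k) : Matrix (Fin 2) (Fin 2) k) 1 1) →
            (∃ (M : Type) (_ : Field M) (_ : Algebra F M),
                Module.finrank F M = 2 ∧ IsTotallyReal M ∧ Nonempty (M →ₐ[F] L)) →
            IsAutomorphicOfWeightZero E)
    (hA : EllipticCurves.ModularForms.exists_isNewformOf) (hBC : baseChange_cyclic_cuspidal)
    (hArch : ArthurClozel1989_strongLifting_archimedean) :
    ∀ (K : Type) [Field K] [NumberField K], IsTotallyReal K → ¬ IsSquare (5 : K) →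
      IsGalois ℚ K → IsCyclic (K ≃ₐ[ℚ] K) →
        Thorne2019.PointsRational Thorne2019.E₁ K → Thorne2019.PointsRational Thorne2019.E₂ K →
          1 < Module.finrank ℚ K →
            ∀ E : WeierstrassCurve (𝓞 K), E.Δ ≠ 0 → IsModularEllipticCurve K E := by
  intro K _ _ hK h5 hG hC h₁ h₂ hdeg E hΔ
  haveI := hK
  haveI := hG
  haveI := hC
  haveI : IsSolvable (K ≃ₐ[ℚ] K) := isSolvable_of_comm mul_comm'
  refine Thorne2019.isModularEllipticCurve_of_images_of_forall_baseChange K h₁ h₂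
    (fun E' hΔ' hne => ⟨Box2022.clause_three h3 K E' hΔ' hne,
      Box2022_theorem1_3_five_of_theorem7_6
        (fun F _ _ _ h5F E₀ hΔ₀ hirr => Thorne2016_theorem7_6_of_dihedralLifting h3 hT F h5F E₀ hΔ₀ hirr)
        K E' hΔ' hne h5⟩)
    (fun E₀ hE₀ => isModularEllipticCurve_baseChange_of_one_lt_finrank hA hBC hArch K hdeg E₀ hE₀)
    E hΔ

/-! ### Lemma 3 from Theorem 2 as the tree states it: `FLS2015_theorem3` (first alternative) and
the named fact `Thorne2019_thm2_five` (second alternative)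

The assemblies above take the second alternative of Theorem 2 on the *strong* carrier
(`IsAutomorphicOfWeightZero`, hypothesis `h76`) or through Thm. 7.5 written out (`hT`), because
the field-local core asks the image dichotomy of every curve that is not automorphic of weight
zero. The proof by contradiction only ever visits curves that are not *modular*
(`¬ IsModularEllipticCurve K E`, the weak trace-only notion), and for those the named fact
`Thorne2019_thm2_five` of `ThorneQInfinityModular` — Theorem 2, second alternative, verbatim, with
conclusion `IsModularEllipticCurve` — already yields clause (ii). The theorems below record this:
`Thorne2019_lemma3` from the three named facts `FLS2015_theorem3`, `Thorne2019_thm2_five`,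
`isModularEllipticCurve_baseChange_rat_of_isSolvable`, i.e. from the tree's own statements of
exactly the printed inputs "Theorem 2", "[Fre13]" (proved: `Box2022.clause_three`,
`Thorne2019.moduli_X0_15`, `XsThreeBFive`), "the modularity of all elliptic curves over `ℚ`, and
cyclic base change for `GL₂` [Lan80]". -/

namespace Thorne2019

/-- **Clause (ii) for a non-modular curve, from the named fact `Thorne2019_thm2_five`.** Over a
totally real `K` with `√5 ∉ K`, an `E / 𝓞 K` with `Δ ≠ 0` that is not modular
(`¬ IsModularEllipticCurve K E`) has `E[5]` reducible (contrapositive of Thm. 2, second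
alternative), hence a framing of `E[5]` with image in `B(5)`: a framing exists
(`exists_isTorsionGaloisRep`), it is reducible (`Thorne2016.hasIrreducibleModPGaloisRep_of_isIrreducible`)
and becomes upper triangular after a change of frame
(`FLS2015.exists_isTorsionGaloisRep_borel_of_not_isIrreducible`) — the proof of
`Box2022_theorem1_3_five_of_theorem7_6` with the weak conclusion of the fact in place of the strong
one. [cite: Thorne2019, Thm. 2 (second alternative) and proof of Lemma 3 (1)] -/
theorem exists_isTorsionGaloisRep_borel_five_of_not_isModularEllipticCurve
    (h5 : Thorne2019_thm2_five) (K : Type) [Field K] [NumberField K] [IsTotallyReal K]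
    (h5K : ¬ IsSquare (5 : K)) (E : WeierstrassCurve (𝓞 K)) (hΔ : E.Δ ≠ 0)
    (hE : ¬ IsModularEllipticCurve K E) :
    ∃ ρ : FramedGaloisRep K (ZMod 5) 2, (E.baseChange K).IsTorsionGaloisRep 5 ρ ∧
      ∀ σ : absoluteGaloisGroup K,
        ((ρ σ : GL (Fin 2) (ZMod 5)) : Matrix (Fin 2) (Fin 2) (ZMod 5)) 1 0 = 0 := by
  haveI : Fact (Nat.Prime 5) := ⟨by norm_num⟩
  haveI := FLS2015.isElliptic_baseChange hΔ
  haveI : NeZero ((5 : ℕ) : K) := NeZero.charZero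
  have hred : ¬ (E.baseChange K).HasIrreducibleModPGaloisRep 5 := fun hirr =>
    hE (h5 K ‹IsTotallyReal K› h5K E hΔ hirr)
  obtain ⟨ρ, hρ⟩ := (E.baseChange K).exists_isTorsionGaloisRep 5
  have hnirr : ¬ FramedRep.IsIrreducible ρ := fun hirrρ =>
    hred (Thorne2016.hasIrreducibleModPGaloisRep_of_isIrreducible hρ hirrρ)
  exact FLS2015.exists_isTorsionGaloisRep_borel_of_not_isIrreducible hρ hnirr

/-- **The field-local core of Lemma 3 (2), with the image dichotomy asked only of non-modular
curves.** As `isModularEllipticCurve_of_images_of_forall_baseChange` (of which it is a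
strengthening: a non-modular curve is not automorphic of weight zero,
`not_isAutomorphicOfWeightZero_of_not_isModularEllipticCurve`), but hypothesis (a) is required
only for the `E / 𝓞 K` with `Δ ≠ 0` that are not modular in the weak, trace-only sense
`IsModularEllipticCurve` — the class the proof by contradiction actually visits. Same proof: the
level structures make `E` a `K`-point of `X₀(15) ≅ E₁` or `X(s3, b5) ≅ E₂` (`moduli_X0_15`,
`exists_ratCast_eq_of_pointsRational`, `exists_ratCast_j_of_splitCartan`), rational by hypothesis,
so `j(E) ∈ ℚ`; `j ∈ {0, 1728}` is CM, otherwise the door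
`isModularEllipticCurve_of_jInvariant_eq_ratCast_of_forall_baseChange` applies.
[cite: Thorne2019, Lemma 3 and its proof, Prop. 4] -/
theorem isModularEllipticCurve_of_nonModularImages_of_forall_baseChange
    (K : Type) [Field K] [NumberField K] [IsTotallyReal K]
    (h₁ : PointsRational E₁ K) (h₂ : PointsRational E₂ K)
    (hImg : ∀ E : WeierstrassCurve (𝓞 K), E.Δ ≠ 0 → ¬ IsModularEllipticCurve K E →
      (∃ ρ : FramedGaloisRep K (ZMod 3) 2, (E.baseChange K).IsTorsionGaloisRep 3 ρ ∧
        ((∀ σ : absoluteGaloisGroup K,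
            ((ρ σ : GL (Fin 2) (ZMod 3)) : Matrix (Fin 2) (Fin 2) (ZMod 3)) 1 0 = 0) ∨
          (∀ σ : absoluteGaloisGroup K, (ρ σ : GL (Fin 2) (ZMod 3)) ∈
            Subgroup.closure ({(⟨!![1, 0; 0, 2], !![1, 0; 0, 2], by decide, by decide⟩ :
                GL (Fin 2) (ZMod 3)),
              (⟨!![0, 1; 1, 0], !![0, 1; 1, 0], by decide, by decide⟩ : GL (Fin 2) (ZMod 3))} :
              Set (GL (Fin 2) (ZMod 3)))))) ∧
      ∃ ρ : FramedGaloisRep K (ZMod 5) 2, (E.baseChange K).IsTorsionGaloisRep 5 ρ ∧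
        ∀ σ : absoluteGaloisGroup K,
          ((ρ σ : GL (Fin 2) (ZMod 5)) : Matrix (Fin 2) (Fin 2) (ZMod 5)) 1 0 = 0)
    (hBCK : ∀ E₀ : WeierstrassCurve ℤ, E₀.Δ ≠ 0 → IsModularEllipticCurve K (E₀.baseChange (𝓞 K)))
    (E : WeierstrassCurve (𝓞 K)) (hΔ : E.Δ ≠ 0) : IsModularEllipticCurve K E := by
  by_contra hE
  -- part (1): level structures of a non-modular curve
  obtain ⟨⟨ρ₃, hρ₃, h3⟩, ρ₅, hρ₅, hb5⟩ := hImg E hΔ hE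
  -- the moduli interpretations and `X(K) = X(ℚ)`: `j(E)` is rational
  have hjrat : ∃ j₀ : ℚ, (algebraMap (𝓞 K) K E.c₄) ^ 3 / algebraMap (𝓞 K) K E.Δ = (j₀ : K) := by
    rcases h3 with hb3 | hs3
    · obtain ⟨S, Jn, Jd, hX⟩ := moduli_X0_15
      rcases hX K E hΔ ⟨ρ₃, hρ₃, hb3⟩ ⟨ρ₅, hρ₅, hb5⟩ with ⟨j₀, -, hj⟩ | ⟨x, y, hxy, hJd, hJ⟩
      · exact ⟨j₀, hj⟩
      · exact exists_ratCast_eq_of_pointsRational h₁ hxy hJd hJ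
    · exact exists_ratCast_j_of_splitCartan h₁ h₂ E hΔ ⟨ρ₃, hρ₃, hs3⟩ ⟨ρ₅, hρ₅, hb5⟩
  obtain ⟨j₀, hj⟩ := hjrat
  -- `j ∈ {0, 1728}`: geometric CM, hence modular in the Caraiani–Newton sense
  letI := FLS2015.isElliptic_baseChange (K := K) hΔ
  have hjK : (E.baseChange K).j = (j₀ : K) := (j_baseChange_eq_div hΔ).trans hj
  by_cases h0 : j₀ = 0
  · refine hE (IsModularEllipticCurve.of_hasCM (WeierstrassCurve.HasCM.of_j_eq_zero ?_))
    rw [hjK, h0, Rat.cast_zero]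
  by_cases h1728 : j₀ = 1728
  · refine hE (IsModularEllipticCurve.of_hasCM (WeierstrassCurve.HasCM.of_j_eq_1728 ?_))
    rw [hjK, h1728]
    norm_num
  -- `j ∉ {0, 1728}`: base change + quadratic twist
  exact hE (isModularEllipticCurve_of_jInvariant_eq_ratCast_of_forall_baseChange K hBCK E hΔ j₀
    h0 h1728 hj)

/-- **Lemma 3 (1) ⇒ the image dichotomy of non-modular curves, from Theorem 2 as vendored.** Over
a totally real `K` with `√5 ∉ K`, a non-modular `E / 𝓞 K` (`Δ ≠ 0`) has a framing of `E[3]`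
with image in `B(3)` or `C_s⁺(3)` (first alternative of Thm. 2 = `FLS2015_theorem3` at `p = 3`,
with the proved Prop. 9.1 (a) of [Fre13]: `Box2022.clause_three`, applicable because a non-modular
curve is not automorphic of weight zero) and a framing of `E[5]` with image in `B(5)` (second
alternative = `Thorne2019_thm2_five`, previous theorem).
[cite: Thorne2019, Thm. 2 and proof of Lemma 3 (1)] [cite: FreitasLeHungSiksek2015, Thm. 3, Prop. 9.1 (a)] -/
theorem nonModularImages_of_theorem2 (h3 : FLS2015_theorem3) (h5 : Thorne2019_thm2_five)
    (K : Type) [Field K] [NumberField K] [IsTotallyReal K] (h5K : ¬ IsSquare (5 : K))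
    (E : WeierstrassCurve (𝓞 K)) (hΔ : E.Δ ≠ 0) (hE : ¬ IsModularEllipticCurve K E) :
    (∃ ρ : FramedGaloisRep K (ZMod 3) 2, (E.baseChange K).IsTorsionGaloisRep 3 ρ ∧
      ((∀ σ : absoluteGaloisGroup K,
          ((ρ σ : GL (Fin 2) (ZMod 3)) : Matrix (Fin 2) (Fin 2) (ZMod 3)) 1 0 = 0) ∨
        (∀ σ : absoluteGaloisGroup K, (ρ σ : GL (Fin 2) (ZMod 3)) ∈
          Subgroup.closure ({(⟨!![1, 0; 0, 2], !![1, 0; 0, 2], by decide, by decide⟩ :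
              GL (Fin 2) (ZMod 3)),
            (⟨!![0, 1; 1, 0], !![0, 1; 1, 0], by decide, by decide⟩ : GL (Fin 2) (ZMod 3))} :
            Set (GL (Fin 2) (ZMod 3)))))) ∧
    ∃ ρ : FramedGaloisRep K (ZMod 5) 2, (E.baseChange K).IsTorsionGaloisRep 5 ρ ∧
      ∀ σ : absoluteGaloisGroup K,
        ((ρ σ : GL (Fin 2) (ZMod 5)) : Matrix (Fin 2) (Fin 2) (ZMod 5)) 1 0 = 0 :=
  ⟨Box2022.clause_three h3 K E hΔ (not_isAutomorphicOfWeightZero_of_not_isModularEllipticCurve hΔ hE),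
    exists_isTorsionGaloisRep_borel_five_of_not_isModularEllipticCurve h5 K h5K E hΔ hE⟩

end Thorne2019

/-- **Thorne 2019, Lemma 3 (2) from Theorem 2 as vendored — `FLS2015_theorem3` (first
alternative: "results of Kisin and Langlands–Tunnell, together with [FLHS]") and the named fact
`Thorne2019_thm2_five` (second alternative: "[Tho15]") — and
`isModularEllipticCurve_baseChange_rat_of_isSolvable` ("the modularity of all elliptic curves over
`ℚ`, and cyclic base change for `GL₂` [Lan80]").** The field-local core
`Thorne2019.isModularEllipticCurve_of_nonModularImages_of_forall_baseChange` fed by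
`Thorne2019.nonModularImages_of_theorem2` and by the base-change fact at `K` (the cyclic group
`Gal(K/ℚ)` is solvable). Consequently `Thorne2019_lemma3_holds` is the term
`Thorne2019_lemma3_of_theorem2 FLS2015_theorem3_holds Thorne2019_thm2_five_holds
isModularEllipticCurve_baseChange_rat_of_isSolvable_holds` once these three named facts — the
tree's statements of exactly the printed inputs, nothing at `p = 7` and no lifting theorem written
out as a binder — are discharged.
[cite: Thorne2019, Lemma 3 and its proof, Thm. 2] [cite: FreitasLeHungSiksek2015, Thm. 3, Prop. 9.1 (a)] -/
theorem Thorne2019_lemma3_of_theorem2 (h3 : FLS2015_theorem3) (h5 : Thorne2019_thm2_five)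
    (hBC : isModularEllipticCurve_baseChange_rat_of_isSolvable) : Thorne2019_lemma3 := by
  intro K _ _ hK h5K hG hC h₁ h₂ E hΔ
  haveI := hK
  haveI := hG
  haveI := hC
  haveI : IsSolvable (K ≃ₐ[ℚ] K) := isSolvable_of_comm mul_comm'
  exact Thorne2019.isModularEllipticCurve_of_nonModularImages_of_forall_baseChange K h₁ h₂
    (Thorne2019.nonModularImages_of_theorem2 h3 h5 K h5K) (fun E₀ hE₀ => hBC K E₀ hE₀) E hΔ

/-- **Thorne 2019, Lemma 3 (2) for every `K` with `[K : ℚ] > 1`, from Theorem 2 as vendored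
(`FLS2015_theorem3`, `Thorne2019_thm2_five`) and the three printed inputs of cyclic base change**
(the Modularity Theorem over `ℚ`, `exists_isNewformOf`; Arthur–Clozel's cyclic base change of
prime degree, `baseChange_cyclic_cuspidal`; its archimedean component,
`ArthurClozel1989_strongLifting_archimedean`), the base changes `E₀ ⊗ K` being modular by
`isModularEllipticCurve_baseChange_of_one_lt_finrank`. Verbatim `Thorne2019_lemma3` with the
extra hypothesis `1 < [K : ℚ]` (the excluded fields are the copies of `ℚ`, for which Lemma 3 is
the Modularity Theorem; see `SolvableBaseChangeModularityTowerProofs`).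
[cite: Thorne2019, Lemma 3 and its proof, Thm. 2] [cite: Thorne2016, Lemma 7.1] -/
theorem Thorne2019_lemma3_of_theorem2_of_one_lt_finrank (h3 : FLS2015_theorem3)
    (h5 : Thorne2019_thm2_five) (hA : EllipticCurves.ModularForms.exists_isNewformOf)
    (hBC : baseChange_cyclic_cuspidal) (hArch : ArthurClozel1989_strongLifting_archimedean) :
    ∀ (K : Type) [Field K] [NumberField K], IsTotallyReal K → ¬ IsSquare (5 : K) →
      IsGalois ℚ K → IsCyclic (K ≃ₐ[ℚ] K) →
        Thorne2019.PointsRational Thorne2019.E₁ K → Thorne2019.PointsRational Thorne2019.E₂ K →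
          1 < Module.finrank ℚ K →
            ∀ E : WeierstrassCurve (𝓞 K), E.Δ ≠ 0 → IsModularEllipticCurve K E := by
  intro K _ _ hK h5K hG hC h₁ h₂ hdeg E hΔ
  haveI := hK
  haveI := hG
  haveI := hC
  haveI : IsSolvable (K ≃ₐ[ℚ] K) := isSolvable_of_comm mul_comm'
  exact Thorne2019.isModularEllipticCurve_of_nonModularImages_of_forall_baseChange K h₁ h₂
    (Thorne2019.nonModularImages_of_theorem2 h3 h5 K h5K)
    (fun E₀ hE₀ => isModularEllipticCurve_baseChange_of_one_lt_finrank hA hBC hArch K hdeg E₀ hE₀)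
    E hΔ

end Literature.NumberTheory.Automorphic

end
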